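import Literature.Probability.Percolation.SlabRSWGluingInterleave
import HarnessLib

/-!
# Newman–Tassion–Wu 2017, §3.3 — crossings from two opposite sides to the bottom side

Topic: `Literature/Probability/Percolation`. The planar-crossing hypothesis of GL0 (Thm. 3.6) in
the configuration of Proposition 3.9 (third step): in `R' = [-κn, n+κn] × [0, n]`, a path from the
right side `R(R')` to `X = [0, n/2] × {0}` meets every path from the left side `L(R')` to
`Y = [n/2, n] × {0}`. Reduced to the tree's `exists_mem_support_of_crossing` by extending the
first walk below the rectangle to its left side and the second one to the left of the rectangle up
to its top side. With the symmetry transport of `SlabRSWGluingOrient.lean` this gives GL0 (linear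
regime) for a bottom target segment glued to crossings between the vertical sides.

* `exists_mem_support_of_sides_to_bottom` — lattice walks inside `[L,R] × [B,T]`, `P` from the
  right side to a bottom point `x`, `Q` from the left side to a bottom point `y` with `x ≤ y`
  (first coordinates): they share a vertex.
* `planarCrossing_sides_bottom` — the `PlanarCrossing` hypothesis for `A ⊆` right side,
  `B ⊆` bottom left of `t`, `C ⊆` left side, `D ⊆` bottom right of `t`.
* `glueLinear_seg_bottom_of_cross` — GL0 (linear) for a bottom target segment under the
  planar-crossing hypothesis; `glueLinear_seg_bottom_sides` — **Prop. 3.9's gluing step**: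
  `P_p[A ⟷^S X] · P_p[C ⟷^S Y] ≤ (1 + λ^s) · P_p[C ⟷^S A]` for `A` on the right side, `C` on the
  left side, `X = [x₁, x₂] × {c}`, `Y` on the bottom side to the right of `x₂`.

## Sources

* C. M. Newman, V. Tassion, W. Wu, *Critical percolation and the minimal spanning tree in slabs*,
  Comm. Pure Appl. Math. 70 (2017), arXiv:1512.09107: §3.3, proof of Proposition 3.9 ("the
  gluing Lemma (GL0) inside R′ gives f(n+2κn, n) ≥ h₀(P[L(R′) ↔ Y] ∧ P[X ↔ R(R′)])")
  [NewmanTassionWu2017].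
-/

noncomputable section

namespace Literature.Probability.Percolation

open MeasureTheory LatticeModels SimpleGraph

namespace NTW17

variable {k : ℕ}

/-! ## The lattice-walk statement -/

/-- **Right-to-bottom against left-to-bottom.** Let `P` be a lattice walk of `ℤ²` inside
`[L,R] × [B,T]` from a point of the right side to a point `x` of the bottom side, and `Q` one from a
point of the left side to a point `y` of the bottom side with `x ≤ y` (first coordinates). Then
`P` and `Q` have a common vertex. [cite: NewmanTassionWu2017, §3.3 (proof of Proposition 3.9, third step, hypothesis of GL0)] -/
theorem exists_mem_support_of_sides_to_bottom {L R B T : ℤ} {r x l y : Site 2}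
    (P : (zdGraph 2).Walk r x) (Q : (zdGraph 2).Walk l y)
    (hP : ∀ z ∈ P.support, L ≤ z 0 ∧ z 0 ≤ R ∧ B ≤ z 1 ∧ z 1 ≤ T)
    (hQ : ∀ z ∈ Q.support, L ≤ z 0 ∧ z 0 ≤ R ∧ B ≤ z 1 ∧ z 1 ≤ T)
    (hr : r 0 = R) (hx : x 1 = B) (hl : l 0 = L) (hy : y 1 = B) (hxy : x 0 ≤ y 0) :
    ∃ z ∈ P.support, z ∈ Q.support := by
  rcases hxy.lt_or_eq with hlt | heq
  swap
  · have : x = y := by rw [Site.eq_iff_two]; exact ⟨heq, by rw [hx, hy]⟩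
    exact ⟨x, P.end_mem_support, this ▸ Q.end_mem_support⟩
  have hxb := hP x P.end_mem_support
  have hyb := hQ y Q.end_mem_support
  have hlb := hQ l Q.start_mem_support
  -- auxiliary points
  set x' : Site 2 := ts (x 0, B - 1) with hx'
  set w₀ : Site 2 := ts (L - 1, B - 1) with hw₀
  set y' : Site 2 := ts (y 0, B - 1) with hy'
  set l' : Site 2 := ts (L - 1, l 1) with hl'
  set tp : Site 2 := ts (L - 1, T) with htp
  -- `P` extended: down from `x`, then left along the row `B - 1` to the column `L - 1`
  have s1 : (zdGraph 2).Adj x x' := adj_of_stepKind (.down (by simp [hx', hx]) (by simp [hx']))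
  obtain ⟨Hrow, hHrow⟩ := exists_walk_horizontal (z := w₀) (w := x') (by simp [hw₀, hx'])
    (by simp [hw₀, hx']; omega)
  let P' : (zdGraph 2).Walk r w₀ := P.append (Walk.cons s1 Hrow.reverse)
  -- `Q` extended: from below `y` up to `y`, back along `Q` to `l`, left, then up the column `L - 1`
  have t1 : (zdGraph 2).Adj y' y := adj_of_stepKind (.up (by simp [hy', hy]) (by simp [hy']))
  have t2 : (zdGraph 2).Adj l l' := adj_of_stepKind (.left (by simp [hl', hl]) (by simp [hl']))
  obtain ⟨Vcol, hVcol⟩ := exists_walk_vertical (z := l') (w := tp) (by simp [hl', htp])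
    (by simp [hl', htp]; omega)
  let Q' : (zdGraph 2).Walk y' tp := Walk.cons t1 (Q.reverse.append (Walk.cons t2 Vcol))
  have hP'sup : ∀ z ∈ P'.reverse.support, z ∈ P.support ∨ (z 1 = B - 1 ∧ L - 1 ≤ z 0 ∧ z 0 ≤ x 0) := by
    intro z hz
    rw [Walk.support_reverse, List.mem_reverse] at hz
    simp only [P', Walk.mem_support_append_iff, Walk.support_cons, List.mem_cons,
      Walk.support_reverse, List.mem_reverse] at hz
    rcases hz with hz | rfl | hz
    · exact Or.inl hz
    · exact Or.inl P.end_mem_support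
    · have := hHrow z hz; right; simp [hw₀, hx'] at this; omega
  have hQ'sup : ∀ z ∈ Q'.support, z ∈ Q.support ∨ z = y' ∨ (z 0 = L - 1 ∧ l 1 ≤ z 1 ∧ z 1 ≤ T) := by
    intro z hz
    simp only [Q', Walk.mem_support_append_iff, Walk.support_cons, List.mem_cons,
      Walk.support_reverse, List.mem_reverse] at hz
    rcases hz with rfl | hz | rfl | hz
    · exact Or.inr (Or.inl rfl)
    · exact Or.inl hz
    · exact Or.inl Q.start_mem_support
    · have := hVcol z hz; right; right; simp [hl', htp] at this; omega
  have hP'box : ∀ z ∈ P'.reverse.support, L - 1 ≤ z 0 ∧ z 0 ≤ R ∧ B - 1 ≤ z 1 ∧ z 1 ≤ T := by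
    intro z hz
    rcases hP'sup z hz with h | h
    · have := hP z h; omega
    · omega
  have hQ'box : ∀ z ∈ Q'.support, L - 1 ≤ z 0 ∧ z 0 ≤ R ∧ B - 1 ≤ z 1 ∧ z 1 ≤ T := by
    intro z hz
    rcases hQ'sup z hz with h | rfl | h
    · have := hQ z h; omega
    · simp [hy']; omega
    · omega
  obtain ⟨z, hzP', hzQ'⟩ := exists_mem_support_of_crossing P'.reverse Q' hP'box hQ'box
    (by simp [hw₀]) hr (by simp [hy']) (by simp [htp])
  rcases hP'sup z hzP' with hzP | hzP
  · rcases hQ'sup z hzQ' with hzQ | rfl | hzQ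
    · exact ⟨z, hzP, hzQ⟩
    · have := hP _ hzP; simp [hy'] at this
    · have := hP z hzP; omega
  · rcases hQ'sup z hzQ' with hzQ | rfl | hzQ
    · have := hQ z hzQ; omega
    · simp [hy'] at hzP; omega
    · omega

/-! ## The planar-crossing hypothesis -/

/-- **Right side to bottom-left against left side to bottom-right.** In `S = [a,b] × [c,d]`, every
planar walk in `S` from the right side to a bottom cell left of `t` (inclusive) meets every planar
walk in `S` from the left side to a bottom cell right of `t` (inclusive).
[cite: NewmanTassionWu2017, §3.3 (proof of Proposition 3.9, third step, hypothesis of GL0)] -/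
theorem planarCrossing_sides_bottom {a b c d t : ℤ} {A B C D : Set (ℤ × ℤ)}
    (hA : ∀ z ∈ A, z.1 = b) (hB : ∀ z ∈ B, z.2 = c ∧ z.1 ≤ t) (hC : ∀ z ∈ C, z.1 = a)
    (hD : ∀ z ∈ D, z.2 = c ∧ t ≤ z.1) : PlanarCrossing (boxR a b c d) A B C D := by
  intro l₁ l₂ h₁ h₂ hw₁ hw₂ hS₁ hS₂ hhA hlB hhC hlD
  obtain ⟨x₁, r₁, rfl⟩ := List.exists_cons_of_ne_nil h₁
  obtain ⟨x₂, r₂, rfl⟩ := List.exists_cons_of_ne_nil h₂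
  obtain ⟨e₁, W₁, he₁, hW₁⟩ := exists_walk_of_planarWalk x₁ r₁ hw₁
  obtain ⟨e₂, W₂, he₂, hW₂⟩ := exists_walk_of_planarWalk x₂ r₂ hw₂
  have hbox : ∀ (l : List (ℤ × ℤ)), (∀ z ∈ l, z ∈ boxR a b c d) →
      ∀ {u v : Site 2} (W : (zdGraph 2).Walk u v), (∀ x ∈ W.support, ∃ w ∈ l, ts w = x) →
      ∀ x ∈ W.support, a ≤ x 0 ∧ x 0 ≤ b ∧ c ≤ x 1 ∧ x 1 ≤ d := by
    intro l hl u v W hW x hx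
    obtain ⟨w, hw, rfl⟩ := hW x hx
    have := hl w hw
    rw [mem_boxR_iff] at this
    simpa using this
  have he₁B : e₁ ∈ B := by rw [← he₁]; exact hlB
  have he₂D : e₂ ∈ D := by rw [← he₂]; exact hlD
  simp only [List.head_cons] at hhA hhC
  obtain ⟨hB1, hB2⟩ := hB e₁ he₁B
  obtain ⟨hD1, hD2⟩ := hD e₂ he₂D
  obtain ⟨z, hz₁, hz₂⟩ := exists_mem_support_of_sides_to_bottom W₁ W₂ (hbox _ hS₁ W₁ hW₁)
    (hbox _ hS₂ W₂ hW₂) (by simpa using hA x₁ hhA) (by simpa using hB1) (by simpa using hC x₂ hhC)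
    (by simpa using hD1) (by simp; omega)
  obtain ⟨v₁, hv₁, rfl⟩ := hW₁ z hz₁
  obtain ⟨v₂, hv₂, hv⟩ := hW₂ _ hz₂
  exact ⟨v₁, hv₁, by rwa [← ts_injective hv]⟩

/-! ## GL0 for a bottom target segment -/

/-- **GL0, linear regime, target a bottom segment, under the planar-crossing hypothesis**: in
`S = [a,b] × [c,d]` with `B = [x₁, x₂] × {c}` (`x₁ < x₂`), `A, C ⊆ S` with `dist*(A, C) > 4ρ + 8`
(`ρ ≥ 4`) and `D` arbitrary. [cite: NewmanTassionWu2017, §3.2 (Theorem 3.6 with Remark 3), §3.3 ("by symmetry")] -/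
theorem glueLinear_seg_bottom_of_cross {a b c d x₁ x₂ : ℤ} (hab : a + 3 ≤ b) (hcd : c + 3 ≤ d)
    (hx₁ : a ≤ x₁) (hx : x₁ < x₂) (hx₂ : x₂ ≤ b) {A C Dd : Set (ℤ × ℤ)}
    (hA : A ⊆ boxR a b c d) (hC : C ⊆ boxR a b c d)
    (hcross : PlanarCrossing (boxR a b c d) A {z | z.2 = c ∧ x₁ ≤ z.1 ∧ z.1 ≤ x₂} C Dd)
    (hk : 1 ≤ k) {ρ : ℕ} (hρ : 4 ≤ ρ) (hsep : ∀ a' ∈ A, ∀ c' ∈ C, c' ∉ sqBox a' (4 * ρ + 8))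
    (p : unitInterval) (hp0 : 0 < (p : ℝ)) (hp1 : (p : ℝ) < 1) :
    (bondPercolation (slabGraph 3 k) p).real
        (slabConn k (boxR a b c d) A {z | z.2 = c ∧ x₁ ≤ z.1 ∧ z.1 ≤ x₂}) *
        (bondPercolation (slabGraph 3 k) p).real (slabConn k (boxR a b c d) C Dd) ≤
      (1 + (2 / min (p : ℝ) (1 - p)) ^ (3 * ((5 * k + 4) * (2 * (2 * (3 * ρ + 3)) + 1) ^ 2))) *
        (bondPercolation (slabGraph 3 k) p).real (slabConn k (boxR a b c d) C A) := by
  set g := reflectSwap (c + d) with hgdef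
  have hg : ∀ z w, planarAdj (g z) (g w) ↔ planarAdj z w := planarAdj_reflectSwap (c + d)
  have hgap : ∀ z, g z = (z.2, c + d - z.1) := fun z => by rw [hgdef, reflectSwap_apply]
  let T : SegSetup :=
    { a := c, b := d, c := a, d := b, y₁ := x₁, y₂ := x₂, A := g.symm '' A, C := g.symm '' C,
      hab := hcd, hcd := hab, hy₁ := hx₁, hy := hx, hy₂ := hx₂,
      hA := by
        rintro z ⟨w, hw, rfl⟩
        have h1 := hA hw
        rw [mem_boxR_iff] at h1 ⊢
        have e : g (g.symm w) = w := g.apply_symm_apply w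
        rw [hgap] at e
        have e1 := congrArg Prod.fst e; have e2 := congrArg Prod.snd e
        simp only at e1 e2
        omega
      hC := by
        rintro z ⟨w, hw, rfl⟩
        have h1 := hC hw
        rw [mem_boxR_iff] at h1 ⊢
        have e : g (g.symm w) = w := g.apply_symm_apply w
        rw [hgap] at e
        have e1 := congrArg Prod.fst e; have e2 := congrArg Prod.snd e
        simp only at e1 e2
        omega }
  have hinv : ∀ X : Set (ℤ × ℤ), g '' (g.symm '' X) = X := by
    intro X; rw [← Set.image_comp]; simp
  have hS : g '' T.S = boxR a b c d := image_reflectSwap_boxR c d a b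
  have hA' : g '' T.A = A := hinv A
  have hC' : g '' T.C = C := hinv C
  have hB' : g '' T.B = {z | z.2 = c ∧ x₁ ≤ z.1 ∧ z.1 ≤ x₂} := by
    rw [hgdef, image_reflectSwap_eq]
    have hTB : T.B = {w | w.1 = d ∧ x₁ ≤ w.2 ∧ w.2 ≤ x₂} := rfl
    rw [hTB]
    ext z
    simp only [Set.mem_setOf_eq]
    omega
  have hsep' : ∀ a' ∈ T.A, ∀ c' ∈ T.C, c' ∉ sqBox a' (4 * ρ + 8) := by
    rintro a' ⟨a₀, ha₀, rfl⟩ c' ⟨c₀, hc₀, rfl⟩ hmem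
    apply hsep a₀ ha₀ c₀ hc₀
    have h1 : g (g.symm c₀) ∈ g '' sqBox (g.symm a₀) (4 * ρ + 8) := Set.mem_image_of_mem _ hmem
    rw [g.apply_symm_apply, hgdef, image_reflectSwap_sqBox] at h1
    have e : reflectSwap (c + d) ((reflectSwap (c + d)).symm a₀) = a₀ := Equiv.apply_symm_apply _ a₀
    rw [reflectSwap_apply] at e
    rwa [e] at h1
  have hcross' : PlanarCrossing (g '' T.S) (g '' T.A) (g '' T.B) (g '' T.C) Dd := by
    rw [hS, hA', hB', hC']; exact hcross
  have h := glueLinear_seg_image T g hg hk hρ hsep' hcross' p hp0 hp1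
  rw [hS, hA', hB', hC'] at h
  exact h

/-- **Proposition 3.9's gluing step (GL0, linear regime)**: in `S = [a,b] × [c,d]` with `A` on the
right side, `X = [x₁, x₂] × {c}` (`x₁ < x₂`) on the bottom, `C` on the left side and `Y` on the
bottom to the right of `x₂`, `dist*(A, C) > 4ρ + 8` (`ρ ≥ 4`; automatic when `b - a > 4ρ + 8`):
`P_p[A ⟷^S X] · P_p[C ⟷^S Y] ≤ (1 + λ^s) · P_p[C ⟷^S A]`.
[cite: NewmanTassionWu2017, §3.3 (proof of Proposition 3.9, third step), §3.2 (Theorem 3.6 with Remark 3)] -/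
theorem glueLinear_seg_bottom_sides {a b c d x₁ x₂ : ℤ} (hab : a + 3 ≤ b) (hcd : c + 3 ≤ d)
    (hx₁ : a ≤ x₁) (hx : x₁ < x₂) (hx₂ : x₂ ≤ b) {A C Y : Set (ℤ × ℤ)}
    (hA : ∀ z ∈ A, z ∈ boxR a b c d ∧ z.1 = b) (hC : ∀ z ∈ C, z ∈ boxR a b c d ∧ z.1 = a)
    (hY : ∀ z ∈ Y, z.2 = c ∧ x₂ ≤ z.1) (hk : 1 ≤ k) {ρ : ℕ} (hρ : 4 ≤ ρ)
    (hsep : ∀ a' ∈ A, ∀ c' ∈ C, c' ∉ sqBox a' (4 * ρ + 8))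
    (p : unitInterval) (hp0 : 0 < (p : ℝ)) (hp1 : (p : ℝ) < 1) :
    (bondPercolation (slabGraph 3 k) p).real
        (slabConn k (boxR a b c d) A {z | z.2 = c ∧ x₁ ≤ z.1 ∧ z.1 ≤ x₂}) *
        (bondPercolation (slabGraph 3 k) p).real (slabConn k (boxR a b c d) C Y) ≤
      (1 + (2 / min (p : ℝ) (1 - p)) ^ (3 * ((5 * k + 4) * (2 * (2 * (3 * ρ + 3)) + 1) ^ 2))) *
        (bondPercolation (slabGraph 3 k) p).real (slabConn k (boxR a b c d) C A) :=
  glueLinear_seg_bottom_of_cross hab hcd hx₁ hx hx₂ (fun _ hz => (hA _ hz).1) (fun _ hz => (hC _ hz).1)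
    (planarCrossing_sides_bottom (t := x₂) (fun z hz => (hA z hz).2) (fun _ hz => ⟨hz.1, hz.2.2⟩)
      (fun z hz => (hC z hz).2) hY) hk hρ hsep p hp0 hp1

/-- The planar-crossing hypothesis is symmetric under reversing both walks.
[cite: NewmanTassionWu2017, §3.2 (Theorem 3.6, hypothesis)] -/
theorem PlanarCrossing.reverse_both {S A B C D : Set (ℤ × ℤ)} (h : PlanarCrossing S A B C D) :
    PlanarCrossing S B A D C := by
  intro l₁ l₂ h₁ h₂ hw₁ hw₂ hS₁ hS₂ hhB hlA hhD hlC
  have hr₁ : l₁.reverse ≠ [] := by simpa using h₁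
  have hr₂ : l₂.reverse ≠ [] := by simpa using h₂
  have hw₁' : IsPlanarWalk l₁.reverse := by
    rw [IsPlanarWalk, List.isChain_reverse]
    refine List.IsChain.imp (fun x y hxy => ?_) hw₁
    rcases hxy with hxy | hxy
    · exact Or.inl hxy.symm
    · exact Or.inr (planarAdj_symm hxy)
  have hw₂' : IsPlanarWalk l₂.reverse := by
    rw [IsPlanarWalk, List.isChain_reverse]
    refine List.IsChain.imp (fun x y hxy => ?_) hw₂
    rcases hxy with hxy | hxy
    · exact Or.inl hxy.symm
    · exact Or.inr (planarAdj_symm hxy)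
  obtain ⟨z, hz₁, hz₂⟩ := h l₁.reverse l₂.reverse hr₁ hr₂ hw₁' hw₂'
    (fun z hz => hS₁ z (List.mem_reverse.1 hz)) (fun z hz => hS₂ z (List.mem_reverse.1 hz))
    (by rw [List.head_reverse]; exact hlA) (by rw [List.getLast_reverse]; exact hhB)
    (by rw [List.head_reverse]; exact hlC) (by rw [List.getLast_reverse]; exact hhD)
  exact ⟨z, List.mem_reverse.1 hz₁, List.mem_reverse.1 hz₂⟩

/-! ## GL0 for the full top side, glued to a right-to-left crossing -/

/-- **Proposition 3.9's second step (GL0, linear regime)**: in `S = [a,b] × [c,d]` with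
`B = [a,b] × {d}` the full top side, `A` on the bottom side, `C` on the RIGHT side and `D` on the
left side, `dist*(A, C) > 4ρ + 8`: `P_p[A ⟷^S B] · P_p[C ⟷^S D] ≤ (1 + λ^s) · P_p[C ⟷^S A]`
(companion of `glueLinear_rect_top`, which has `C` on the left side).
[cite: NewmanTassionWu2017, §3.3 (proof of Proposition 3.9, second step: "P[X ↔^R R(R)] ≥ h₀(…)"), §3.2 (Theorem 3.6 with Remark 3)] -/
theorem glueLinear_rect_top' {a b c d : ℤ} (hab : a + 3 ≤ b) (hcd : c + 3 ≤ d) {A C Dd : Set (ℤ × ℤ)}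
    (hA : ∀ z ∈ A, z ∈ boxR a b c d ∧ z.2 = c) (hC : ∀ z ∈ C, z ∈ boxR a b c d ∧ z.1 = b)
    (hDd : ∀ z ∈ Dd, z.1 = a) (hk : 1 ≤ k) {ρ : ℕ} (hρ : 2 ≤ ρ)
    (hsep : ∀ a' ∈ A, ∀ c' ∈ C, c' ∉ sqBox a' (4 * ρ + 8))
    (p : unitInterval) (hp0 : 0 < (p : ℝ)) (hp1 : (p : ℝ) < 1) :
    (bondPercolation (slabGraph 3 k) p).real
        (slabConn k (boxR a b c d) A {z | z ∈ boxR a b c d ∧ z.2 = d}) *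
        (bondPercolation (slabGraph 3 k) p).real (slabConn k (boxR a b c d) C Dd) ≤
      (1 + (2 / min (p : ℝ) (1 - p)) ^ (3 * ((5 * k + 4) * (2 * (6 * ρ + 4) + 1) ^ 2))) *
        (bondPercolation (slabGraph 3 k) p).real (slabConn k (boxR a b c d) C A) := by
  let T : RectSetup :=
    { a := c, b := d, c := a, d := b, A := planarSwap '' A, C := planarSwap '' C,
      hab := hcd, hcd := hab,
      hA := by
        rintro z ⟨w, hw, rfl⟩
        have := (hA w hw).1
        rw [mem_boxR_iff] at this ⊢
        simp only [planarSwap_apply, Prod.fst_swap, Prod.snd_swap]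
        omega
      hC := by
        rintro z ⟨w, hw, rfl⟩
        have := (hC w hw).1
        rw [mem_boxR_iff] at this ⊢
        simp only [planarSwap_apply, Prod.fst_swap, Prod.snd_swap]
        omega
      hAB := by
        rintro z ⟨w, hw, rfl⟩
        have h1 := (hA w hw).1
        have h2 := (hA w hw).2
        rw [mem_boxR_iff] at h1
        simp only [planarSwap_apply, Prod.fst_swap]
        omega }
  have hswap : ∀ z w, planarAdj (planarSwap z) (planarSwap w) ↔ planarAdj z w := planarAdj_planarSwap
  have hinv : ∀ X : Set (ℤ × ℤ), planarSwap '' (planarSwap '' X) = X := by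
    intro X; ext z
    simp only [Set.mem_image, planarSwap_apply]
    constructor
    · rintro ⟨w, ⟨v, hv, rfl⟩, rfl⟩; simpa using hv
    · intro hz; exact ⟨z.swap, ⟨z, hz, rfl⟩, by simp⟩
  have hS : planarSwap '' T.S = boxR a b c d := image_planarSwap_boxR _ _ _ _
  have hA' : planarSwap '' T.A = A := hinv A
  have hC' : planarSwap '' T.C = C := hinv C
  have hB' : planarSwap '' T.B = {z | z ∈ boxR a b c d ∧ z.2 = d} := by
    rw [image_planarSwap_eq]
    have hTB : T.B = {w | w ∈ boxR c d a b ∧ w.1 = d} := rfl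
    rw [hTB]
    ext z
    simp only [Set.mem_setOf_eq, mem_boxR_iff, Prod.fst_swap, Prod.snd_swap]
    omega
  have hsep' : ∀ a' ∈ T.A, ∀ c' ∈ T.C, c' ∉ sqBox a' (4 * ρ + 8) := by
    rintro a' ⟨a₀, ha₀, rfl⟩ c' ⟨c₀, hc₀, rfl⟩ hmem
    apply hsep a₀ ha₀ c₀ hc₀
    have : planarSwap c₀ ∈ planarSwap '' sqBox a₀ (4 * ρ + 8) := by
      rw [image_planarSwap_sqBox]; exact hmem
    obtain ⟨w, hw, hww⟩ := this
    rwa [← planarSwap.injective hww]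
  -- in `[a,b] × [c,d]`: `A` bottom, `B` top, `C` right, `D` left: a bottom-top against a
  -- right-left crossing
  have hcross : PlanarCrossing (planarSwap '' T.S) (planarSwap '' T.A) (planarSwap '' T.B)
      (planarSwap '' T.C) Dd := by
    rw [hS, hA', hB', hC']
    exact (planarCrossing_rect' (a := a) (b := b) (c := c) (d := d) (A := Dd) (B := C)
      (C := {z | z ∈ boxR a b c d ∧ z.2 = d}) (D := A) hDd (fun z hz => (hC z hz).2)
      (fun z hz => hz.2) (fun z hz => (hA z hz).2)).swap_pairs.reverse_both
  have h := glueLinear_image T planarSwap hswap hk hρ hsep' hcross p hp0 hp1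
  rw [hS, hA', hB', hC'] at h
  exact h

end NTW17

end Literature.Probability.Percolation
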